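import Literature.Analysis.FluidPDE.SelfSimilarEulerVorticityExteriorEstimate
import HarnessLib

/-!
# Self-similar Euler profiles: the exterior weighted `L^p` inequality, large exponent

Analysis/FluidPDE proofs file (theorems only) on the discharge path of the named fact
`Literature.Analysis.FluidPDE.chaeShvydkoy2013_vorticity_exclusion` (Chae–Shvydkoy, ARMA 209
(2013) = arXiv:1201.6009, Thm 4.1), companion of `SelfSimilarEulerVorticityExteriorEstimate.lean`:
the same level inequality for exponents `p = 2a ≥ 2`, where the weight `|Ω|^p = (|Ω|²)^a` is
itself `C¹` (Mathlib `HasFDerivAt.rpow_const` with `1 ≤ a`) and the `ε`-regularisation of the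
small-exponent case is unnecessary (and would not be dominated by `|Ω|^{2a}`). CS13's hypothesis
(ii) `ω ∈ L^p`, `0 < p < 3/(1+α)`, allows `p ≥ 2` when `α < 1/2`.

* `hasFDerivAt_rpow_norm_sq_of_one_le`, `fderiv_rpow_norm_sq_apply_of_one_le`,
  `contDiff_rpow_norm_sq_of_one_le`, `rpow_sub_one_mul_self_le_rpow` — calculus of `(|Ω|²)^a`,
  `a ≥ 1`;
* `IsSelfSimilarEulerVorticityProfile.integral_rpow_norm_sq_curl_weight_le_of_one_le` — for
  `1 ≤ a`: `3γ ∫ |Ω|^{2a} φ τ_L ≤ 2a(1+η) ∫ φ |Ω|^{2a} + 5MC ∫ 𝟙_{|y−c| ≥ L} |Ω|^{2a}` under the same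
  transport/stretching hypotheses as the small-exponent version (proof verbatim the same, with
  `G = |Ω|^{2a}` in place of `G_ε`).

## References

* D. Chae, R. Shvydkoy, ARMA 209 (2013) = arXiv:1201.6009, §4, proof of Thm 4.1.
  [ChaeShvydkoy2013]
-/

noncomputable section

open MeasureTheory Set Filter Function Topology InnerProductSpace Metric
open scoped RealInnerProductSpace NNReal

namespace Literature.Analysis.FluidPDE

/-! ### The power `(|Ω|²)^a`, `a ≥ 1` -/

section LargePower

variable {Ω : EuclideanSpace ℝ (Fin 3) → EuclideanSpace ℝ (Fin 3)}

/-- For a differentiable field `Ω` and `a ≥ 1`, `y ↦ (|Ω(y)|²)^a` is differentiable everywhere with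
`D(y) w = 2a (|Ω(y)|²)^{a−1} ⟪Ω(y), DΩ(y) w⟫` (also at zeros of `Ω`). [cite: ChaeShvydkoy2013, §4, proof of Thm 4.1 (the multiplier |ω|^(p-2))] -/
theorem hasFDerivAt_rpow_norm_sq_of_one_le (hΩ : Differentiable ℝ Ω) {a : ℝ} (ha1 : 1 ≤ a)
    (y : EuclideanSpace ℝ (Fin 3)) :
    HasFDerivAt (fun z => (‖Ω z‖ ^ 2) ^ a)
      ((2 * a * (‖Ω y‖ ^ 2) ^ (a - 1)) • (innerSL ℝ (Ω y)).comp (fderiv ℝ Ω y)) y := by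
  have h1 : HasFDerivAt (fun z => ‖Ω z‖ ^ 2)
      ((innerSL ℝ (Ω y)).comp (fderiv ℝ Ω y) + (innerSL ℝ (Ω y)).comp (fderiv ℝ Ω y)) y := by
    have h := (hΩ y).hasFDerivAt.norm_sq
    rw [two_smul] at h
    exact h
  refine (h1.rpow_const (Or.inr ha1)).congr_fderiv ?_
  ext w
  simp only [_root_.smul_apply, _root_.add_apply, ContinuousLinearMap.coe_comp,
    Function.comp_apply, innerSL_apply_apply, smul_eq_mul]
  ring

/-- The derivative of `(|Ω|²)^a`, `a ≥ 1`, along a vector. [cite: ChaeShvydkoy2013, §4, proof of Thm 4.1 (the multiplier |ω|^(p-2))] -/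
theorem fderiv_rpow_norm_sq_apply_of_one_le (hΩ : Differentiable ℝ Ω) {a : ℝ} (ha1 : 1 ≤ a)
    (y w : EuclideanSpace ℝ (Fin 3)) :
    fderiv ℝ (fun z => (‖Ω z‖ ^ 2) ^ a) y w =
      2 * a * (‖Ω y‖ ^ 2) ^ (a - 1) * (⟪Ω y, fderiv ℝ Ω y w⟫ ) := by
  rw [(hasFDerivAt_rpow_norm_sq_of_one_le hΩ ha1 y).fderiv]
  simp only [_root_.smul_apply, ContinuousLinearMap.coe_comp, Function.comp_apply,
    innerSL_apply_apply, smul_eq_mul]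

/-- `(|Ω|²)^a` is `C¹` when `Ω` is and `a ≥ 1`. [cite: ChaeShvydkoy2013, §4, proof of Thm 4.1 (the multiplier |ω|^(p-2))] -/
theorem contDiff_rpow_norm_sq_of_one_le (hΩ : ContDiff ℝ 1 Ω) {a : ℝ} (ha1 : 1 ≤ a) :
    ContDiff ℝ 1 (fun z => (‖Ω z‖ ^ 2) ^ a) := by
  have h1 : ContDiff ℝ (1 : ℕ) (fun z => ‖Ω z‖ ^ 2) := hΩ.norm_sq ℝ
  exact h1.rpow_const_of_le (by exact_mod_cast ha1)

/-- For `0 ≤ f` and real `a`: `f^{a−1} f ≤ f^a` (equality for `f > 0`, `0 ≤ 0` at `f = 0`). [cite: ChaeShvydkoy2013, §4, proof of Thm 4.1 (the multiplier |ω|^(p-2))] -/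
theorem rpow_sub_one_mul_self_le_rpow {f : ℝ} (hf : 0 ≤ f) (a : ℝ) :
    f ^ (a - 1) * f ≤ f ^ a := by
  rcases hf.eq_or_lt with h | h
  · rw [← h, mul_zero]
    exact Real.rpow_nonneg le_rfl _
  · rw [Real.rpow_sub_one h.ne']
    field_simp
    exact le_rfl

end LargePower

/-! ### The exterior weighted inequality at level `L`, exponent `a ≥ 1` -/

namespace IsSelfSimilarEulerVorticityProfile

variable {γ : ℝ} {c : EuclideanSpace ℝ (Fin 3)}
  {U : EuclideanSpace ℝ (Fin 3) → EuclideanSpace ℝ (Fin 3)}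

/-- **The exterior weighted `L^p`-type inequality at level `L`, large exponent** (CS13 §4, proof
of Thm 4.1, with smooth radial weights; the case `p = 2a ≥ 2`, where `|Ω|^p` is `C¹` and no
regularisation is needed). Hypotheses: a vorticity-form profile (any `γ`); `1 ≤ a`; radii
`0 < R₀ ≤ R`, `1 ≤ L`; eventual outward radial transport `0 ≤ ⟪V(y), y − c⟫` for `|y − c| ≥ R₀` and quadratic growth `|⟪V(y), y − c⟫| ≤ C (1 + |y − c|²)` (`V = γ(y−c) + U`); small
stretching `|⟪Ω, DU Ω⟫| ≤ η |Ω|²` for `|y − c| ≥ R`; `|Ω|^{2a} ∈ L¹`; `M` a bound for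
`|smoothTransition'|`. Conclusion:
`3γ ∫ |Ω|^{2a} φ τ_L ≤ 2a(1+η) ∫ φ |Ω|^{2a} + 5MC ∫ 𝟙_{|y−c| ≥ L} |Ω|^{2a}` with
`φ = 1 − θ_{2R,R}(· − c)`, `τ_L = θ_{2L,L}(· − c)`. [cite: ChaeShvydkoy2013, §4, proof of Thm 4.1 (display (4.2) and the estimate following it)] -/
theorem integral_rpow_norm_sq_curl_weight_le_of_one_le
    (h : IsSelfSimilarEulerVorticityProfile γ c U) {a : ℝ} (ha1 : 1 ≤ a)
    {M : ℝ} (hM : ∀ s, |deriv Real.smoothTransition s| ≤ M)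
    {R₀ R L C η : ℝ} (hR₀ : 0 < R₀) (hR : R₀ ≤ R) (hL : 1 ≤ L) (hη : 0 ≤ η)
    (hout : ∀ y, R₀ ≤ ‖y - c‖ → 0 ≤ ⟪selfSimilarTransport γ c U y, y - c⟫)
    (hgrowth : ∀ y, |⟪selfSimilarTransport γ c U y, y - c⟫| ≤ C * (1 + ‖y - c‖ ^ 2))
    (hstretch : ∀ y, R ≤ ‖y - c‖ → |⟪curl U y, fderiv ℝ U y (curl U y)⟫| ≤ η * ‖curl U y‖ ^ 2)
    (hint : Integrable (fun y => (‖curl U y‖ ^ 2) ^ a)) :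
    3 * γ * ∫ y, (‖curl U y‖ ^ 2) ^ a *
        ((1 - taoCutoff (2 * R) R (y - c)) * taoCutoff (2 * L) L (y - c)) ≤
      (2 * a * (1 + η) * ∫ y, (1 - taoCutoff (2 * R) R (y - c)) * (‖curl U y‖ ^ 2) ^ a) +
        5 * M * C * ∫ y, Set.indicator {y | L ≤ ‖y - c‖} (fun y => (‖curl U y‖ ^ 2) ^ a) y := by
  -- names
  set Ω : EuclideanSpace ℝ (Fin 3) → EuclideanSpace ℝ (Fin 3) := curl U with hΩdef
  set V : EuclideanSpace ℝ (Fin 3) → EuclideanSpace ℝ (Fin 3) := selfSimilarTransport γ c U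
    with hVdef
  have ha : 0 < a := by linarith
  set G : EuclideanSpace ℝ (Fin 3) → ℝ := fun z => (‖Ω z‖ ^ 2) ^ a with hGdef
  set φ : EuclideanSpace ℝ (Fin 3) → ℝ := fun z => 1 - taoCutoff (2 * R) R (z - c) with hφdef
  set τ : EuclideanSpace ℝ (Fin 3) → ℝ := fun z => taoCutoff (2 * L) L (z - c) with hτdef
  set w : EuclideanSpace ℝ (Fin 3) → ℝ := fun z => φ z * τ z with hwdef
  have hRpos : 0 < R := hR₀.trans_le hR
  have hLpos : 0 < L := by linarith
  have hM0 : 0 ≤ M := (abs_nonneg _).trans (hM 0)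
  have hC0 : 0 ≤ C := by
    have h1 := hgrowth c
    simp only [sub_self, inner_zero_right, abs_zero, norm_zero] at h1
    linarith
  -- regularity
  have hU2 : ContDiff ℝ 2 U := h.contDiff_velocity
  have hΩ1 : ContDiff ℝ 1 Ω := contDiff_curl (n := 1) (by exact_mod_cast hU2)
  have hΩd : Differentiable ℝ Ω := h.differentiable_curl
  have hΩc : Continuous Ω := hΩ1.continuous
  have hUd : Differentiable ℝ U := hU2.differentiable (by norm_num)
  have hV1 : ContDiff ℝ 1 V := by
    have : ContDiff ℝ 1 fun y : EuclideanSpace ℝ (Fin 3) => γ • (y - c) + U y :=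
      ((contDiff_id.sub contDiff_const).const_smul γ).add (hU2.of_le (by norm_num))
    exact this
  have hG1 : ContDiff ℝ 1 G := contDiff_rpow_norm_sq_of_one_le hΩ1 ha1
  have hφ1 : ContDiff ℝ 1 φ := contDiff_const.sub (contDiff_taoCutoff_comp_sub (2 * R) R c)
  have hτ1 : ContDiff ℝ 1 τ := contDiff_taoCutoff_comp_sub (2 * L) L c
  have hw1 : ContDiff ℝ 1 w := hφ1.mul hτ1
  have hΘ1 : ContDiff ℝ 1 (fun z => G z * w z) := hG1.mul hw1
  -- compact support of the test function (from `τ`)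
  have hτc : HasCompactSupport τ := by
    refine HasCompactSupport.of_support_subset_isCompact (isCompact_closedBall c (2 * L))
      fun z hz => ?_
    rw [mem_closedBall, dist_eq_norm]
    by_contra hcon
    exact hz (taoCutoff_comp_sub_eq_zero hLpos.le (not_le.1 hcon).le)
  have hwc : HasCompactSupport w := hτc.mul_left
  have hΘc : HasCompactSupport (fun z => G z * w z) := hwc.mul_left
  -- pointwise facts on the weights
  have hφ_mem : ∀ z, φ z ∈ Icc (0 : ℝ) 1 := fun z => by
    have hm := taoCutoff_comp_sub_mem_Icc R c z
    exact ⟨by simp only [hφdef]; linarith [hm.2], by simp only [hφdef]; linarith [hm.1]⟩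
  have hτ_mem : ∀ z, τ z ∈ Icc (0 : ℝ) 1 := fun z => taoCutoff_comp_sub_mem_Icc L c z
  have hw_mem : ∀ z, w z ∈ Icc (0 : ℝ) 1 := fun z =>
    ⟨mul_nonneg (hφ_mem z).1 (hτ_mem z).1, mul_le_one₀ (hφ_mem z).2 (hτ_mem z).1 (hτ_mem z).2⟩
  have hφ_zero : ∀ z, ‖z - c‖ ≤ R → φ z = 0 := fun z hz => by
    simp only [hφdef, taoCutoff_comp_sub_eq_one hRpos hz, sub_self]
  have hfa_nn : ∀ z, 0 ≤ G z := fun z => Real.rpow_nonneg (sq_nonneg _) _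
  have hG_mem : ∀ z, G z ∈ Icc 0 (G z) := fun z => ⟨hfa_nn z, le_rfl⟩
  -- integration by parts: `∫ Θ div V + ∫ ⟪V, ∇Θ⟫ = 0`, `div V = 3γ`
  have hibp := integral_mul_divergence_add_eq_zero_left hΘ1 hV1 hΘc
  have hdiv : ∀ y, VectorCalculus.divergence V y = 3 * γ := fun y =>
    divergence_selfSimilarTransport hUd h.divFree y
  simp_rw [hdiv] at hibp
  rw [integral_mul_const] at hibp
  -- the derivative of the test function along `V`
  have hDφ : ∀ y, DifferentiableAt ℝ φ y := fun y => hφ1.differentiable one_ne_zero y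
  have hDτ : ∀ y, DifferentiableAt ℝ τ y := fun y => hτ1.differentiable one_ne_zero y
  have hDG : ∀ y, DifferentiableAt ℝ G y := fun y => hG1.differentiable one_ne_zero y
  have hDw : ∀ y, DifferentiableAt ℝ w y := fun y => hw1.differentiable one_ne_zero y
  have hgrad : ∀ y, ⟪V y, gradient (fun z => G z * w z) y⟫ =
      w y * fderiv ℝ G y (V y) + G y * (τ y * fderiv ℝ φ y (V y) + φ y * fderiv ℝ τ y (V y)) := by
    intro y
    rw [real_inner_comm, inner_gradient_left (𝕜 := ℝ), fderiv_fun_mul (hDG y) (hDw y)]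
    have hw' : fderiv ℝ w y = φ y • fderiv ℝ τ y + τ y • fderiv ℝ φ y := fderiv_fun_mul (hDφ y) (hDτ y)
    rw [hw']
    simp only [_root_.add_apply, _root_.smul_apply, smul_eq_mul]
    ring
  -- (1) the main term: `-w DG(V) ≤ 2a(1+η) φ fa`
  have hT1 : ∀ y, -(w y * fderiv ℝ G y (V y)) ≤ 2 * a * (1 + η) * (φ y * G y) := by
    intro y
    have hid : fderiv ℝ G y (V y) =
        2 * a * (‖Ω y‖ ^ 2) ^ (a - 1) * (⟪Ω y, fderiv ℝ U y (Ω y)⟫ - ‖Ω y‖ ^ 2) := by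
      rw [hGdef, fderiv_rpow_norm_sq_apply_of_one_le hΩd ha1, hΩdef, hVdef,
        h.fderiv_curl_transport y, inner_sub_right, real_inner_self_eq_norm_sq]
    by_cases hy : ‖y - c‖ ≤ R
    · -- inside `B̄(c,R)`: `φ = 0`, both sides vanish
      have : w y = 0 := by simp only [hwdef, hφ_zero y hy, zero_mul]
      rw [this, hφ_zero y hy]
      simp
    · have hyR : R ≤ ‖y - c‖ := (not_le.1 hy).le
      rw [hid]
      have hfe : 0 ≤ (‖Ω y‖ ^ 2) ^ (a - 1) := Real.rpow_nonneg (by positivity) _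
      have hb : -(⟪Ω y, fderiv ℝ U y (Ω y)⟫ - ‖Ω y‖ ^ 2) ≤ (1 + η) * ‖Ω y‖ ^ 2 := by
        have := (abs_le.1 (hstretch y hyR)).1
        nlinarith
      have hkey : (‖Ω y‖ ^ 2) ^ (a - 1) * ‖Ω y‖ ^ 2 ≤ G y :=
        rpow_sub_one_mul_self_le_rpow (sq_nonneg _) a
      have hwle : w y ≤ φ y := by
        have := mul_le_mul_of_nonneg_left (hτ_mem y).2 (hφ_mem y).1
        simpa [hwdef] using this
      calc -(w y * (2 * a * (‖Ω y‖ ^ 2) ^ (a - 1) *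
              (⟪Ω y, fderiv ℝ U y (Ω y)⟫ - ‖Ω y‖ ^ 2)))
          = w y * (2 * a * ((‖Ω y‖ ^ 2) ^ (a - 1) *
              -(⟪Ω y, fderiv ℝ U y (Ω y)⟫ - ‖Ω y‖ ^ 2))) := by ring
        _ ≤ w y * (2 * a * ((‖Ω y‖ ^ 2) ^ (a - 1) * ((1 + η) * ‖Ω y‖ ^ 2))) :=
            mul_le_mul_of_nonneg_left (mul_le_mul_of_nonneg_left
              (mul_le_mul_of_nonneg_left hb hfe) (by positivity)) (hw_mem y).1
        _ = 2 * a * (1 + η) * (w y * ((‖Ω y‖ ^ 2) ^ (a - 1) * ‖Ω y‖ ^ 2)) := by ring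
        _ ≤ 2 * a * (1 + η) * (φ y * G y) :=
            mul_le_mul_of_nonneg_left
              (mul_le_mul hwle hkey (mul_nonneg hfe (sq_nonneg _)) (hφ_mem y).1) (by positivity)
  -- (2) the exterior-weight term has a sign: `-G τ Dφ(V) ≤ 0`
  have hT2 : ∀ y, -(G y * (τ y * fderiv ℝ φ y (V y))) ≤ 0 := by
    intro y
    rw [neg_nonpos]
    refine mul_nonneg (hG_mem y).1 (mul_nonneg (hτ_mem y).1 ?_)
    by_cases hy : ‖y - c‖ < R
    · -- inside `B(c,R)`, `φ` is locally constant
      have h0 : fderiv ℝ φ y = 0 := by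
        have := fderiv_taoCutoff_comp_sub_eq_zero_of_lt hRpos hy
        rw [hφdef, fderiv_const_sub, this, neg_zero]
      rw [h0]
      simp
    · have hyR : R₀ ≤ ‖y - c‖ := hR.trans (not_lt.1 hy)
      have hsign : 0 ≤ ⟪y - c, V y⟫ := by rw [real_inner_comm]; exact hout y hyR
      exact fderiv_one_sub_taoCutoff_comp_sub_apply_nonneg hRpos hsign
  -- (3) the large cutoff term: `|G φ Dτ(V)| ≤ 5MC fa 𝟙_{|y−c| ≥ L}`
  have hT3 : ∀ y, -(G y * (φ y * fderiv ℝ τ y (V y))) ≤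
      5 * M * C * Set.indicator {y | L ≤ ‖y - c‖} G y := by
    intro y
    by_cases hyL : ‖y - c‖ < L
    · have h0 : fderiv ℝ τ y = 0 := fderiv_taoCutoff_comp_sub_eq_zero_of_lt hLpos hyL
      have hnot : y ∉ {y : EuclideanSpace ℝ (Fin 3) | L ≤ ‖y - c‖} := fun hmem => by
        simp only [mem_setOf_eq] at hmem
        linarith
      rw [h0, Set.indicator_of_notMem hnot]
      simp
    · have hyL' : L ≤ ‖y - c‖ := not_lt.1 hyL
      rw [Set.indicator_of_mem (by exact hyL')]
      by_cases hy2 : 2 * L < ‖y - c‖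
      · have h0 : fderiv ℝ τ y = 0 := fderiv_taoCutoff_comp_sub_eq_zero_of_gt hLpos.le hy2
        rw [h0, _root_.zero_apply, mul_zero, mul_zero, neg_zero]
        exact mul_nonneg (by positivity) (hfa_nn y)
      · have hy2' : ‖y - c‖ ≤ 2 * L := not_lt.1 hy2
        -- `|Dτ(V)| ≤ (M/L²) |⟪y−c, V⟫| ≤ (M/L²) C (1 + 4L²) ≤ 5 M C`
        have hD : |fderiv ℝ τ y (V y)| ≤ 5 * M * C := by
          have h1 := abs_fderiv_taoCutoff_comp_sub_apply_le hM hLpos c y (V y)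
          have h2 : |⟪y - c, V y⟫| ≤ C * (1 + ‖y - c‖ ^ 2) := by
            rw [real_inner_comm]; exact hgrowth y
          have h3 : C * (1 + ‖y - c‖ ^ 2) ≤ C * (1 + (2 * L) ^ 2) := by
            gcongr
          have h4 : M / L ^ 2 * (C * (1 + (2 * L) ^ 2)) ≤ 5 * M * C := by
            have hL2 : 1 ≤ L ^ 2 := by nlinarith
            rw [div_mul_eq_mul_div, div_le_iff₀ (by positivity)]
            nlinarith [mul_nonneg hM0 hC0]
          calc |fderiv ℝ τ y (V y)| ≤ M / L ^ 2 * |⟪y - c, V y⟫| := h1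
            _ ≤ M / L ^ 2 * (C * (1 + (2 * L) ^ 2)) := by
                gcongr
                exact h2.trans h3
            _ ≤ 5 * M * C := h4
        have hGφ : |G y * φ y| ≤ G y := by
          rw [abs_mul, abs_of_nonneg (hG_mem y).1, abs_of_nonneg (hφ_mem y).1]
          calc G y * φ y ≤ G y * 1 := mul_le_mul (hG_mem y).2 (hφ_mem y).2 (hφ_mem y).1 (hfa_nn y)
            _ = G y := mul_one _
        have : |G y * (φ y * fderiv ℝ τ y (V y))| ≤ G y * (5 * M * C) := by
          rw [← mul_assoc, abs_mul]
          exact mul_le_mul hGφ hD (abs_nonneg _) (hfa_nn y)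
        have := (abs_le.1 this).1
        linarith
  -- integrability of everything in sight
  have hfa_cont : Continuous G := (hΩc.norm.pow 2).rpow_const fun _ => Or.inr ha.le
  have hφc' : Continuous φ := hφ1.continuous
  have hI1 : Integrable (fun y => φ y * G y) := by
    refine Integrable.mono' hint (hφc'.aestronglyMeasurable.mul hfa_cont.aestronglyMeasurable)
      (ae_of_all _ fun y => ?_)
    rw [Real.norm_eq_abs, abs_mul, abs_of_nonneg (hφ_mem y).1, abs_of_nonneg (hfa_nn y)]
    exact mul_le_of_le_one_left (hfa_nn y) (hφ_mem y).2
  have hI3 : Integrable (Set.indicator {y | L ≤ ‖y - c‖} G) := by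
    refine hint.indicator ?_
    exact (isClosed_le continuous_const (continuous_id.sub continuous_const).norm).measurableSet
  have hIgrad : Integrable (fun y => ⟪V y, gradient (fun z => G z * w z) y⟫) := by
    refine (hV1.continuous.inner (continuous_gradient_of_contDiff hΘ1))
      |>.integrable_of_hasCompactSupport (hΘc.mono' fun x hx => ?_)
    contrapose! hx
    simp only [mem_support, not_not]
    rw [gradient_eq_zero_of_notMem_tsupport hx, inner_zero_right]
  -- assemble: `3γ ∫ G w = -∫ ⟪V, ∇Θ⟫ ≤ ∫ (bound₁ + 0 + bound₃)`
  have hptw : ∀ y, -⟪V y, gradient (fun z => G z * w z) y⟫ ≤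
      2 * a * (1 + η) * (φ y * G y) + 5 * M * C * Set.indicator {y | L ≤ ‖y - c‖} G y := by
    intro y
    rw [hgrad y]
    have := hT1 y
    have := hT2 y
    have := hT3 y
    linarith
  have hle : -∫ y, ⟪V y, gradient (fun z => G z * w z) y⟫ ≤
      ∫ y, (2 * a * (1 + η) * (φ y * G y) +
        5 * M * C * Set.indicator {y | L ≤ ‖y - c‖} G y) := by
    rw [← integral_neg]
    exact integral_mono hIgrad.neg ((hI1.const_mul _).add (hI3.const_mul _)) hptw
  rw [integral_add (hI1.const_mul _) (hI3.const_mul _), integral_const_mul, integral_const_mul]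
    at hle
  have e : 3 * γ * ∫ y, G y * w y = -∫ y, ⟪V y, gradient (fun z => G z * w z) y⟫ := by linarith
  calc 3 * γ * ∫ y, G y * (φ y * τ y) = 3 * γ * ∫ y, G y * w y := by rfl
    _ = -∫ y, ⟪V y, gradient (fun z => G z * w z) y⟫ := e
    _ ≤ (2 * a * (1 + η) * ∫ y, φ y * G y) +
          5 * M * C * ∫ y, Set.indicator {y | L ≤ ‖y - c‖} G y := hle

end IsSelfSimilarEulerVorticityProfile

end Literature.Analysis.FluidPDE

end
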